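import Mathlib
import Literature.MathematicalPhysics.QuantumFieldTheory.Balaban1983to89.Setup
import Literature.MathematicalPhysics.QuantumFieldTheory.Balaban1983to89.Step
import Literature.MathematicalPhysics.QuantumFieldTheory.Balaban1983to89.StepInhabited

/-!
# `Balaban1983to89.B14` — T. Bałaban, *Convergent renormalization expansions for lattice gauge theories*,
Commun. Math. Phys. **119**, 243–285 (1988), doi:10.1007/bf01217741.  (Cell numbering: B14 = "[III]" of
[Balaban1989LargeFieldI]/[Balaban1989LargeFieldII]; its refs: [I] = [Balaban1987RG1] (B12), [II] = [Balaban1988RG2Cluster]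
(B13), numeric [n] = B12's list.)  PDF held: `paper:balaban1988-cmp119-convergent-renormalization`
(= `paper:doi-10-1007-bf01217741`; journal page = PDF page + 242).

CITATION HEADER (lean-in-tree rule 2026-08-18).  This module is a TYPED SKELETON (statement level) of the published
paper [Balaban1988Convergent] (cell paper B14).  WHAT IS REPRODUCED: Theorem 1 (p. 262) and Theorem 2 (p. 263, (2.43),
(2.44)) VERBATIM as `def … : Prop` over an abstract carrier of the §2 "inductive description"; the flow inequalities
(2.6)–(2.9) (pp. 255–256) and the bounds (2.45)–(2.49) (pp. 263–264) as Props; the numerical definitions (2.5), (2.28)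
as a predicate / function; and KERNEL-CHECKED RE-DERIVATIONS of two elementary displayed steps of §2: (a) which
properties of the β-functions give the flow inequalities (2.6) (`flow26_upper_of_rg`, `flow26_lower_of_rg`), (b) the
geometric-series step in (2.45) (`geomStep_245`).  NOTHING of the series is asserted; every `…Printed` Prop is consumed
downstream only as a hypothesis.  Adjudication content carried here (cell GAPS.md ids): the hypothesis "(I.0.33)" of
Theorem 1 does not resolve ([I] §0 ends at (0.32), p. 260) [G2] — it is a PARAMETER `H033` below with the cell's two
instantiations (`H033Interval` = the interval hypothesis of [I] Thms 1/3, `H033LogRunning` = (0.31) of the unproved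
[I] Thm 2); (2.6) is justified in print only by "The inequalities follow from the renormalization group equations
(0.20) [I], and from the properties of the β-functions", while [I] p. 264 prints of β only smoothness and uniform
boundedness with all derivatives ("We will investigate other properties in a separate paper") — the lemmas of the
section "Which properties of the β-functions give (2.6)" record that an UPPER bound β_j ≤ β′ gives the first member and
a SIGN β_j ≥ 0 gives the last member, the sign being the unprinted input [G-r2.1]; Corollary 3 (2.50) p. 264
(ultraviolet stability) is typed with both printed dependence readings in `…Balaban1983to89.B16`, here only the
sentence that is its whole printed proof [G-r2.5].  The 𝐑 operation is ASSUMED in this paper (p. 244: *"The operation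
𝐑 serves this purpose. We will not describe it here, we will only assume that it has some properties incorporated in
the inductive description of the effective actions."*); constructed in [Balaban1989LargeFieldI]/[Balaban1989LargeFieldII].
Vocabulary: uses `Setup.Flow` (couplings and β-functions), `Flow.SatisfiesRG` (= (2.24) with φ_j = 1 = (I.0.20)),
`Flow.InInterval`; the profile (2.4) `p₀(g)`, `ε_j = g_j p₀(g_j)` is `Setup.p0Profile`/`Setup.epsK` (not restated).
Why a local carrier `Sect2Data` for Thms 1–2: the printed statements quantify over the terms E^{(j)}, R^{(j)} of the
representation (2.18) and the point sets Γ_n of admissible sequences of regions, whose clause-by-clause content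
((2.1)–(2.42), some forty displayed conditions) is the business of the cell's `Step` module; at statement level they
are NAMED as fields.  The cell's staged `Step` module (Part A) re-derives (2.6) over raw real sequences as well; the
versions here are stated over `Setup.Flow`.  Staged byte-identically in the cell package
`run/shared/lean/pub/pub-balaban/lean/BalabanYm4/Literature/…/B14.lean` (legacy Mathlib-only copy `BalabanYm4/B14.lean`
there, namespace `BalabanYm4.B14`).  Unit `b2b-balaban-r2` (reader group B+C); companion prose `HOME/b2b-balaban-r2/B14.md`,
`HOME/FINAL-STATEMENT.md` §2 (every clause of §2 with equation numbers).
Revision v2 (2026-08-18, cell referee finding R5.7): `Thm2Printed` is stated for a FAMILY of runs `fam : I → Sect2Data`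
with the constants `E₁`, `R₁` quantified BEFORE the run index, so that the printed "independent of j, k, Ω, {Ω_j},
{Λ_j}, T" (T = the torus, which varies from run to run) and "absolute constant R₁" are expressed (v1 fixed one run,
losing the T-uniformity — the same convention as `…B10.Thm1Printed`, `…B11.Thm1Printed`); `Bounds245to249` carries the
printed binder `κ₀ ≥ 7` of (2.46), under which the ℕ-exponent `κ₀ − 6` is the printed one.
Revision v3 (2026-08-18, surge node T11.1 of the cell CLAIM TABLE, unit `b2b-balaban-pv04`): + section "Surge nodes" — the
**Theorem of p. 245** (§0: *"If ρ_k satisfies the assumptions described in detail in Sect. 2, then Tρ_k satisfies also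
the corresponding assumptions"*) typed VERBATIM at the density level of the cell's `…Balaban1983to89.Step` module
(Part D1 `Step.DensityRG`: the sequence (0.2) `ρ_k = 𝐑Tρ_{k−1}` with its operations; hence the new `import …Step`,
which itself imports only `Setup`) in its two readings `ThmP245Printed` (ρ_k the given iterate) / `ThmP245Spaces`
(all densities of the index-k space, p. 262 second remark), the ASSUMED property of 𝐑 (p. 244) `RAssumedP244`, and
the kernel-checked bookkeeping Thm 1 (p. 262) ⇐ start + p. 245 Theorem + assumed 𝐑 along (0.2)
(`inductiveAssumptions_of_thmP245`, `thm1Printed_of_thmP245`, `mapsSpaces_of_thmP245Spaces`); cell GAPS.md G-pv04-1,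
DIVERGENCE.md D-pv04.1.  Also corrects the reference number in the Cor. 3 remark below ("[6]", not "[16]": cell
DIVERGENCE.md D-adv3-1 / GAPS.md G-adv3-1; render of p. 264 re-read).
Revision v4 (2026-08-18, unit `b2b-balaban-pv04` gen 3; the B14 row of the cell's Setup v1.3/v1.4 MIGRATION TABLE, `HOME/STEP.md`
§7, GAPS.md C-f2.11): ADDITIVE — + `import …StepInhabited` and section "Surge nodes over the inhabited carrier": the same two
readings of the p. 245 Theorem and the same bookkeeping, typed over the INHABITED renormalization-transformation carrier
`Setup.RTOpI` (push-forward identity asked only of integrable densities; cell DIVERGENCE.md F17) and the step datum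
`Step.DensityRGI` — `ThmP245PrintedI`, `ThmP245SpacesI` (bodies use only the operators `(T k).T`, exactly as before),
`Iff.rfl` bridges along `Setup.RTOp.toRTOpI` / `Step.DensityRG.toI` (`thmP245PrintedI_toRTOpI_iff`, `thmP245SpacesI_toRTOpI_iff`,
`thmP245PrintedI_toI_iff`, `thmP245SpacesI_toI_iff`), `thmP245PrintedI_of_spacesI`, `mapsSpaces_of_thmP245SpacesI`
(⊢ `Step.DensityRGI.MapsSpaces`), `inductiveAssumptions_of_thmP245I`, `inSpace_all_of_thmP245SpacesI` (via
`Step.DensityRGI.inSpace_all`) and `thm1Printed_of_thmP245I` (⊢ the unchanged `Thm1Printed`).  Every v3 declaration is kept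
byte-identical (importers: `B14Cor3`, `B14Thm2`, `DagBinding`, …); no new quotation of print — the I-forms carry the v3
quotations (cross-read: cell GAPS.md C-pv10-4).
-/

namespace Literature.MathematicalPhysics.QuantumFieldTheory.Balaban1983to89.B14

open Literature.MathematicalPhysics.QuantumFieldTheory.Balaban1983to89

/-! ## §2 numerics: (2.5), (2.28) ((2.4) = `Setup.p0Profile` / `Setup.epsK`) -/

/-- **(2.5)** p. 255 [13], verbatim: *"R_j is the smallest number of the form L^r such, that R_j ≥ (log g_j⁻²)^r."*
The letter `r` is printed twice; typed reading (cell DIVERGENCE.md D-r2.2): `R_j = L^s` for the least `s : ℕ` with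
`L^s ≥ (log g_j⁻²)^r`, `r` a fixed positive integer (`Setup.Consts.r`).  Stated as a predicate on `Rj`. [cite: Balaban1988Convergent, (2.5) p.255] -/
def IsRj (L : ℕ) (r : ℕ) (gj : ℝ) (Rj : ℕ) : Prop :=
  ∃ s : ℕ, Rj = L ^ s ∧ (Real.log (gj ^ 2)⁻¹) ^ r ≤ (Rj : ℝ) ∧
    ∀ s' : ℕ, (Real.log (gj ^ 2)⁻¹) ^ r ≤ ((L ^ s' : ℕ) : ℝ) → s ≤ s'

/-- **(2.28)** p. 259 [17], verbatim: *"α_{0,j} = g_j C₀ (log g_j⁻²)^{q₀}, α_{1,j} = g_j C₁ (log g_j⁻²)^{q₁}, where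
q₀, q₁ are integers greater than 1, C₀, C₁ are sufficiently large positive numbers."*  One function of (C, q, g_j)
serving both. [cite: Balaban1988Convergent, (2.28) p.259] -/
noncomputable def alphaJ (Cc : ℝ) (q : ℕ) (gj : ℝ) : ℝ := gj * Cc * (Real.log (gj ^ 2)⁻¹) ^ q

/-! ## The flow inequalities (2.6)–(2.9) -/

/-- **(2.6)** p. 255 [13], verbatim: *"The coupling constants g_j satisfy the inequalities
g_n ≤ (1 + g_n² β′(n−m))^{1/2} g_m ≤ (1 + g_n² β′)^{1/2} (n−m)^{1/2} g_m ≤ (1+β₀)(n−m)^{1/2} g_m ,  g_m ≤ (1+β₀) g_n , (2.6)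
where n > m, and β₀ > 0 can be chosen arbitrarily small, if g is sufficiently small. The inequalities follow from the
renormalization group equations (0.20) [I], and from the properties of the β-functions."*  Typed for all
`m < n ≤ K` over a coupling sequence `g` (first and last members; the middle members are arithmetic). [cite: Balaban1988Convergent, (2.6) p.255] -/
def FlowIneq26 (g : ℕ → ℝ) (β' β₀ : ℝ) (K : ℕ) : Prop :=
  ∀ m n, m < n → n ≤ K →
    g n ≤ Real.sqrt (1 + (g n) ^ 2 * β' * ((n : ℝ) - m)) * g m ∧ g m ≤ (1 + β₀) * g n

/-- **(2.7)** p. 255 [13], verbatim: *"(log g_n⁻²)^p ≤ (1+β₀)(log g_m⁻²)^p, (log g_m⁻²)^p ≤ (1 + g_n² β′(n−m))^{β₀}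
(log g_n⁻²)^p ≤ (1+β₀)(n−m)^{β₀}(log g_n⁻²)^p, (2.7) where p is a positive integer."* [cite: Balaban1988Convergent, (2.7) p.255] -/
def FlowIneq27 (g : ℕ → ℝ) (β' β₀ : ℝ) (p : ℕ) (K : ℕ) : Prop :=
  ∀ m n, m < n → n ≤ K →
    (Real.log ((g n) ^ 2)⁻¹) ^ p ≤ (1 + β₀) * (Real.log ((g m) ^ 2)⁻¹) ^ p ∧
    (Real.log ((g m) ^ 2)⁻¹) ^ p ≤ (1 + (g n) ^ 2 * β' * ((n : ℝ) - m)) ^ β₀ * (Real.log ((g n) ^ 2)⁻¹) ^ p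

/-- **(2.8)** p. 256 [14], verbatim: *"ε_n ≤ (1+β₀)(n−m)^{1/2} ε_m, ε_m ≤ (1+β₀)(1 + g_n² β′(n−m))^{β₀} ε_n ≤
(1+β₀)²(n−m)^{β₀} ε_n"*; (2.9): *"R_n ≤ L R_m, R_m ≤ L(1 + g_n² β′(n−m))^{β₀} R_n ≤ (L+1)(n−m)^{β₀} R_n."*  *"Similar
inequalities hold for other constants, which will be introduced later."*  Typed: (2.8) for a sequence `ε` along `g`. [cite: Balaban1988Convergent, (2.8)–(2.9) p.256] -/
def FlowIneq28 (ε : ℕ → ℝ) (g : ℕ → ℝ) (β' β₀ : ℝ) (K : ℕ) : Prop :=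
  ∀ m n, m < n → n ≤ K →
    ε n ≤ (1 + β₀) * Real.sqrt ((n : ℝ) - m) * ε m ∧
    ε m ≤ (1 + β₀) * (1 + (g n) ^ 2 * β' * ((n : ℝ) - m)) ^ β₀ * ε n

/-! ### Which properties of the β-functions give (2.6) — kernel-checked (cell GAPS.md G-r2.1)

[I] p. 264 prints only: β_{j+1}(g_j) "is a smooth function defined on the interval [0, γ], (or analytic), uniformly
bounded on this interval together with all derivatives. We will investigate other properties in a separate paper."
The lemmas below show, for a `Setup.Flow` satisfying the RG equations (I.0.20) up to K: an UPPER bound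
`β_{j+1}(g_j) ≤ β′` along the flow gives the first member of (2.6); a LOWER bound `β_{j+1}(g_j) ≥ 0` along the flow
gives `g_m ≤ g_n` (n > m), hence the last member for any β₀ ≥ 0.  Boundedness alone does not give the last member
uniformly in `n − m ≤ K = log_L ε⁻¹`; no sign / lower bound of β_j is printed in [I]–[IV].  These lemmas are NOT
asserted to be the author's intended derivation; they record one sufficient set of "properties of the β-functions". -/

/-- Telescoping (I.0.20) with an upper bound on the β-terms along the flow: `1/g_m² ≤ 1/g_n² + β′(n − m)` for
`m ≤ n ≤ K`.  Elementary. [folklore] -/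
theorem inv_sq_le_of_rg_upper (F : Flow) (K : ℕ) (β' : ℝ)
    (hrg : F.SatisfiesRG K) (hb : ∀ j, j < K → F.β (j + 1) (F.g j) ≤ β') :
    ∀ m n, m ≤ n → n ≤ K → 1 / (F.g m) ^ 2 ≤ 1 / (F.g n) ^ 2 + β' * ((n : ℝ) - m) := by
  intro m n hmn hnK
  induction n, hmn using Nat.le_induction with
  | base => simp
  | succ n hmn ih =>
    have hnK' : n < K := Nat.lt_of_succ_le hnK
    have h1 := ih (le_of_lt hnK')
    have h2 := hrg n hnK'
    have h3 := hb n hnK'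
    push_cast
    linarith

/-- Telescoping (I.0.20) with the lower bound 0 on the β-terms along the flow: `1/g_n² ≤ 1/g_m²` for `m ≤ n ≤ K`.
Elementary. [folklore] -/
theorem inv_sq_le_of_rg_nonneg (F : Flow) (K : ℕ)
    (hrg : F.SatisfiesRG K) (hb : ∀ j, j < K → 0 ≤ F.β (j + 1) (F.g j)) :
    ∀ m n, m ≤ n → n ≤ K → 1 / (F.g n) ^ 2 ≤ 1 / (F.g m) ^ 2 := by
  intro m n hmn hnK
  induction n, hmn using Nat.le_induction with
  | base => simp
  | succ n hmn ih =>
    have hnK' : n < K := Nat.lt_of_succ_le hnK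
    have h1 := ih (le_of_lt hnK')
    have h2 := hrg n hnK'
    have h3 := hb n hnK'
    linarith

/-- First member of (2.6), squared form: from `1/g_m² ≤ 1/g_n² + c` with `c ≥ 0` and positive couplings,
`g_n² ≤ (1 + g_n² c) g_m²`.  Elementary. [folklore] -/
theorem sq_le_of_inv_sq_le (gm gn c : ℝ) (hm : 0 < gm) (hn : 0 < gn) (hc : 0 ≤ c)
    (h : 1 / gm ^ 2 ≤ 1 / gn ^ 2 + c) : gn ^ 2 ≤ (1 + gn ^ 2 * c) * gm ^ 2 := by
  have hm2 : 0 < gm ^ 2 := by positivity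
  have hn2 : 0 < gn ^ 2 := by positivity
  rw [div_le_iff₀ hm2] at h
  have h3 : gn ^ 2 * ((1 / gn ^ 2 + c) * gm ^ 2) = (1 + gn ^ 2 * c) * gm ^ 2 := by
    field_simp
  have h2 : gn ^ 2 * 1 ≤ gn ^ 2 * ((1 / gn ^ 2 + c) * gm ^ 2) := mul_le_mul_of_nonneg_left h (le_of_lt hn2)
  linarith [h2, h3]

/-- **(2.6), first member, from (I.0.20) + `β_{j+1}(g_j) ≤ β′` (β′ ≥ 0) + positivity of the couplings**: for
`m < n ≤ K`, `g_n ≤ (1 + g_n² β′ (n−m))^{1/2} g_m`.  Elementary. [folklore] -/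
theorem flow26_upper_of_rg (F : Flow) (K : ℕ) (β' : ℝ) (hβ' : 0 ≤ β')
    (hpos : ∀ j, j ≤ K → 0 < F.g j) (hrg : F.SatisfiesRG K)
    (hb : ∀ j, j < K → F.β (j + 1) (F.g j) ≤ β') :
    ∀ m n, m < n → n ≤ K → F.g n ≤ Real.sqrt (1 + (F.g n) ^ 2 * β' * ((n : ℝ) - m)) * F.g m := by
  intro m n hmn hnK
  have hm : 0 < F.g m := hpos m (le_trans (le_of_lt hmn) hnK)
  have hn : 0 < F.g n := hpos n hnK
  have hc : 0 ≤ β' * ((n : ℝ) - m) := by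
    have : (m : ℝ) ≤ n := by exact_mod_cast (le_of_lt hmn)
    exact mul_nonneg hβ' (by linarith)
  have hsq := sq_le_of_inv_sq_le (F.g m) (F.g n) (β' * ((n : ℝ) - m)) hm hn hc
    (inv_sq_le_of_rg_upper F K β' hrg hb m n (le_of_lt hmn) hnK)
  have hfac : 0 ≤ 1 + (F.g n) ^ 2 * β' * ((n : ℝ) - m) := by nlinarith [sq_nonneg (F.g n)]
  have heq : (1 + (F.g n) ^ 2 * (β' * ((n : ℝ) - m))) = 1 + (F.g n) ^ 2 * β' * ((n : ℝ) - m) := by ring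
  rw [heq] at hsq
  calc F.g n = Real.sqrt ((F.g n) ^ 2) := by rw [Real.sqrt_sq (le_of_lt hn)]
    _ ≤ Real.sqrt ((1 + (F.g n) ^ 2 * β' * ((n : ℝ) - m)) * (F.g m) ^ 2) := Real.sqrt_le_sqrt hsq
    _ = Real.sqrt (1 + (F.g n) ^ 2 * β' * ((n : ℝ) - m)) * F.g m := by
        rw [Real.sqrt_mul hfac, Real.sqrt_sq (le_of_lt hm)]

/-- **(2.6), last member, from (I.0.20) + `β_{j+1}(g_j) ≥ 0` + positivity**: for `m < n ≤ K` and any `β₀ ≥ 0`,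
`g_m ≤ (1 + β₀) g_n` (indeed `g_m ≤ g_n`).  Elementary. [folklore] -/
theorem flow26_lower_of_rg (F : Flow) (K : ℕ) (β₀ : ℝ) (hβ₀ : 0 ≤ β₀)
    (hpos : ∀ j, j ≤ K → 0 < F.g j) (hrg : F.SatisfiesRG K)
    (hb : ∀ j, j < K → 0 ≤ F.β (j + 1) (F.g j)) :
    ∀ m n, m < n → n ≤ K → F.g m ≤ (1 + β₀) * F.g n := by
  intro m n hmn hnK
  have hm : 0 < F.g m := hpos m (le_trans (le_of_lt hmn) hnK)
  have hn : 0 < F.g n := hpos n hnK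
  have hinv := inv_sq_le_of_rg_nonneg F K hrg hb m n (le_of_lt hmn) hnK
  have hmn' : F.g m ≤ F.g n := by
    have hsq : F.g m ^ 2 ≤ F.g n ^ 2 := by
      rwa [one_div_le_one_div (by positivity) (by positivity)] at hinv
    nlinarith [hsq, hm, hn]
  nlinarith [hmn', hn, hβ₀]

/-- Summary in the shape of (2.6): RG equations + `0 ≤ β_{j+1}(g_j) ≤ β′` along the flow + positivity ⇒
`FlowIneq26 F.g β′ β₀ K` for every β₀ ≥ 0.  One sufficient set of "properties of the β-functions" (the sign is the
unprinted one, cell GAPS.md G-r2.1). [folklore] -/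
theorem flowIneq26_of_rg_two_sided (F : Flow) (K : ℕ) (β' β₀ : ℝ) (hβ' : 0 ≤ β') (hβ₀ : 0 ≤ β₀)
    (hpos : ∀ j, j ≤ K → 0 < F.g j) (hrg : F.SatisfiesRG K)
    (hub : ∀ j, j < K → F.β (j + 1) (F.g j) ≤ β') (hlb : ∀ j, j < K → 0 ≤ F.β (j + 1) (F.g j)) :
    FlowIneq26 F.g β' β₀ K := fun m n hmn hnK =>
  ⟨flow26_upper_of_rg F K β' hβ' hpos hrg hub m n hmn hnK,
   flow26_lower_of_rg F K β₀ hβ₀ hpos hrg hlb m n hmn hnK⟩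

/-! ## Theorem 1, Theorem 2 (pp. 262–263); (2.45)–(2.49) -/

/-- Abstract carrier for the objects of §2 at statement level: the number of steps `K`, the flow (couplings
"determined by (0.18), (0.20) [I]" and β-functions), for each `k` the predicate `InductiveAssumption k` = "ρ_k has the
representation (2.18) with all clauses (2.1)–(2.42) and the constant E_k" (p. 262: "satisfies all the inductive
assumptions"), and for the bounds of Theorem 2 an index type `Ω` of the remaining data (j, k, Ω, {Ω_j}, {Λ_j}, T,
φ, U_k admissible) with `eTerm j k ω` = |Σ_{z∈Λ_j^0∩Ω}[E^{(j)}(Λ_j,U_k,z) − E^{(j)}(Λ_j,1,z)] − β_j(g_{j−1})A(φ,U_k)|,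
`rTerm j k ω` = |Σ_{X∈𝐃_j, X⊂Λ_j, X∩Ω≠∅}[R^{(j)}(X,U_k) − R^{(j)}(X,1)]|, `gammaVol n ω` = |Γ_n ∩ Ω|. [cite: Balaban1988Convergent, (2.18) + (2.43)–(2.44) pp.257–263] -/
structure Sect2Data where
  K : ℕ
  flow : Flow
  InductiveAssumption : ℕ → Prop
  Ω : Type
  eTerm : ℕ → ℕ → Ω → ℝ
  rTerm : ℕ → ℕ → Ω → ℝ
  gammaVol : ℕ → Ω → ℝ

/-- **Theorem 1**, verbatim (p. 262 [20]): *"There exist constants, introduced in the above description, such that if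
the sequence of coupling constants {g_k}, determined by the recursive renormalization group (Callan-Symanzik)
equations (0.18), (0.20) [I], satisfies the inequalities (I.0.33), then the sequence of densities {ρ_k}, generated by
successive applications of the operations 𝐑T to the density ρ₀ = exp[−(1/g₀²)A − E], satisfies all the inductive
assumptions. The constants satisfy numerous restrictions introduced in the proof."*  Remarks p. 262: *"some of the
restrictions on constants, e.g. on constants κ, M, ε_j, α_{0,j}, α_{1,j}, come from the paper [I]. We assume that all
of them are satisfied here, and we will introduce some new restrictions also."*  "(I.0.33)" does not resolve ([I] §0
ends at (0.32), p. 260; cell GAPS.md G2): the hypothesis is a PARAMETER `H033`, see `H033Interval` / `H033LogRunning`.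
"determined by (0.20) [I]" = `Setup.Flow.SatisfiesRG`.  Typed for ONE datum `S` with the constants fixed inside it
("there exist constants" = the choice of the datum). [cite: Balaban1988Convergent, Thm 1 p.262] -/
def Thm1Printed (H033 : Flow → ℕ → Prop) (S : Sect2Data) : Prop :=
  S.flow.SatisfiesRG S.K → H033 S.flow S.K → ∀ k, k ≤ S.K → S.InductiveAssumption k

/-- The cell's first instantiation of "(I.0.33)" (cell DIVERGENCE.md D2c): the interval hypothesis of [I] Thms 1/3,
`0 < g_k ≤ γ`, `k = 0,…,K` (`Setup.Flow.InInterval`). [cite: Balaban1987RG1, Thm 1 p.259] -/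
def H033Interval (γ : ℝ) : Flow → ℕ → Prop := fun F K => F.InInterval γ K

/-- The alternative instantiation: (0.31) of [I] (conclusion of the unproved [I] Thm 2) with `g_K = g` renamed `gR`
and `log(L^k ε)⁻¹ = (K − k) log L` (ε = L^{-K}); = `Setup.Flow.LogRunning` after that substitution. [cite: Balaban1987RG1, (0.31) p.259] -/
def H033LogRunning (L gR β β' : ℝ) : Flow → ℕ → Prop := fun F K =>
  ∀ k, k ≤ K → 1 / gR ^ 2 + β * (((K : ℝ) - k) * Real.log L) ≤ 1 / (F.g k) ^ 2 ∧
    1 / (F.g k) ^ 2 ≤ 1 / gR ^ 2 + β' * (((K : ℝ) - k) * Real.log L)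

/-- **Theorem 2**, verbatim (p. 263 [21]): *"Under the assumptions of Theorem 1 there exists a constant E₁ independent
of j, k, Ω, {Ω_j}, {Λ_j}, T (but dependent on the other constants occurring in the formulation of this theorem), such
that
| Σ_{z∈Λ_j^0∩Ω} [E^{(j)}(Λ_j, U_k, z) − E^{(j)}(Λ_j, 1, z)] − β_j(g_{j−1}) A(φ, U_k) | ≤ E₁ Σ_{n=j}^{k} (L^{j−n})^β |Γ_n ∩ Ω| , (2.43)
for β < 1, and sufficiently regular configurations U_k = U_k(V), e.g. for V restricted by the characteristic functions
in (2.18). The constant E₁ depends on β also, and grows to ∞ if β → 1. … Similarly, there exists an absolute constant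
R₁ such, that
| Σ_{X∈𝐃_j, X⊂Λ_j, X∩Ω≠∅} [R^{(j)}(X, U_k) − R^{(j)}(X, 1)] | ≤ R₁ g_j^{κ₀} Σ_{n=j}^{k} |Γ_n ∩ Ω| , (2.44)
for the regular configurations U_k. (In fact the constant R₁ can be taken as equal to 1 for g_j sufficiently
small.)"*  Typed over a FAMILY of runs `fam : I → Sect2Data` (the index ranges over the tori T, i.e. over
(K, m), and over the admissible sequences {Ω_j}, {Λ_j}; the "other constants occurring in the formulation" — d, L, the
constants of the inductive description, β — are fixed for the family), each run under the hypotheses of `Thm1Printed`;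
`β < 1` is chosen first ("E₁ depends on β also"), then E₁ and R₁ are quantified BEFORE the run index `i` and before
(j, k, ω) — this is the printed uniformity "independent of j, k, Ω, {Ω_j}, {Λ_j}, T" and "absolute constant R₁"
(revision v2; v1 fixed a single run). [cite: Balaban1988Convergent, Thm 2 (2.43)–(2.44) p.263] -/
def Thm2Printed (H033 : Flow → ℕ → Prop) {I : Type} (fam : I → Sect2Data) (L β : ℝ) (κ₀ : ℕ) : Prop :=
  β < 1 → ∃ E₁ R₁ : ℝ, ∀ i : I, (fam i).flow.SatisfiesRG (fam i).K → H033 (fam i).flow (fam i).K →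
    (∀ j k ω, 1 ≤ j → j ≤ k → k ≤ (fam i).K →
        |(fam i).eTerm j k ω| ≤ E₁ * ∑ n ∈ Finset.Icc j k, (L ^ ((j : ℝ) - n)) ^ β * (fam i).gammaVol n ω) ∧
    (∀ j k ω, 1 ≤ j → j ≤ k → k ≤ (fam i).K →
        |(fam i).rTerm j k ω| ≤ R₁ * ((fam i).flow.g j) ^ κ₀ * ∑ n ∈ Finset.Icc j k, (fam i).gammaVol n ω)

/-- Bookkeeping (proved): the family version specialises to any single run — for each `i`, under that run's
hypotheses, constants E₁, R₁ bounding its terms exist (the v1, one-run reading). [folklore] -/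
theorem thm2_single_of_family (H033 : Flow → ℕ → Prop) {I : Type} (fam : I → Sect2Data) (L β : ℝ) (κ₀ : ℕ)
    (h : Thm2Printed H033 fam L β κ₀) (hβ : β < 1) (i : I)
    (hrg : (fam i).flow.SatisfiesRG (fam i).K) (h033 : H033 (fam i).flow (fam i).K) :
    (∃ E₁ : ℝ, ∀ j k ω, 1 ≤ j → j ≤ k → k ≤ (fam i).K →
        |(fam i).eTerm j k ω| ≤ E₁ * ∑ n ∈ Finset.Icc j k, (L ^ ((j : ℝ) - n)) ^ β * (fam i).gammaVol n ω) ∧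
    (∃ R₁ : ℝ, ∀ j k ω, 1 ≤ j → j ≤ k → k ≤ (fam i).K →
        |(fam i).rTerm j k ω| ≤ R₁ * ((fam i).flow.g j) ^ κ₀ * ∑ n ∈ Finset.Icc j k, (fam i).gammaVol n ω) := by
  obtain ⟨E₁, R₁, hall⟩ := h hβ
  obtain ⟨hE, hR⟩ := hall i hrg h033
  exact ⟨⟨E₁, hE⟩, ⟨R₁, hR⟩⟩

/-- The geometric-series step displayed in **(2.45)** p. 263 [21]: `Σ_{j=1}^{n} (L^{j−n})^β < (1 − L^{−β})^{−1}` for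
`L > 1`, `β > 0` — re-derived in the form: with `q = L^{-β}`, `Σ_{i<n} q^i ≤ (1 − q)⁻¹` for `0 ≤ q < 1`.
Elementary. [folklore] -/
theorem geomStep_245 (q : ℝ) (hq0 : 0 ≤ q) (hq1 : q < 1) (n : ℕ) :
    ∑ i ∈ Finset.range n, q ^ i ≤ (1 - q)⁻¹ := by
  have hpos : 0 < 1 - q := by linarith
  have hmul : (∑ i ∈ Finset.range n, q ^ i) * (1 - q) = 1 - q ^ n := geom_sum_mul_neg q n
  have hqn : 0 ≤ q ^ n := pow_nonneg hq0 n
  rw [← one_div, le_div_iff₀ hpos]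
  linarith

/-- **(2.45)–(2.49)** pp. 263–264 [21–22], verbatim: *"|𝐄_k(U_k)| ≤ E₁ Σ_{n=1}^{k} |Γ_n| Σ_{j=1}^{n} (L^{j−n})^β <
E₁ (1 − L^{−β})^{−1} Σ_{n=1}^{k} |Γ_n|"* (2.45); *"|𝐑_k(U_k)| ≤ R₁ Σ_{n=1}^{k} |Γ_n| Σ_{j=1}^{n} g_j^{κ₀} <
R₁ Σ_{n=1}^{k} |Γ_n| g_n^{κ₀−6} < Σ_{n=1}^{k} |Γ_n| , for κ₀ ≥ 7 and g sufficiently small"* (2.46); *"|𝐁^{(j,n)}(U_k, A,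
{S_i})| ≤ B₁ 2^{−(j−n)} |Γ_n|"*, *"|(2.40)| ≤ 2B₁ (Σ_{n=1}^{k−1} |Γ_n| + |Γ_k∖Λ_k^0|) ≤ 2B₁ Σ_{n=1}^{k} |Γ_n|"*
(2.47)–(2.48); *"A_k(1/g_k², U_k) = −A(1/g_k², U_k) + (the logarithmic terms) + O(1) Σ_{j=1}^{k} |Γ_j|"* (2.49).  Typed as
the shape of the conclusion for the total pieces `Etot`, `Rtot`, `Btot` at step k; the (2.46) clause carries its
printed binder `κ₀ ≥ 7` (so the ℕ-exponent `κ₀ − 6 ≥ 1` is the printed one; revision v2).  (The middle member of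
(2.46) needs (0.31)-type running of the couplings, not the interval hypothesis alone — cell GAPS.md G-f2.1.) [cite: Balaban1988Convergent, (2.45)–(2.49) pp.263–264] -/
def Bounds245to249 (Etot Rtot Btot : ℝ) (E₁ R₁ B₁ L β : ℝ) (g : ℕ → ℝ) (κ₀ : ℕ)
    (gammaVol : ℕ → ℝ) (k : ℕ) : Prop :=
  |Etot| ≤ E₁ * (1 - L ^ (-β))⁻¹ * ∑ n ∈ Finset.Icc 1 k, gammaVol n ∧
  (7 ≤ κ₀ →
    |Rtot| ≤ R₁ * ∑ n ∈ Finset.Icc 1 k, gammaVol n * (g n) ^ (κ₀ - 6) ∧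
      R₁ * ∑ n ∈ Finset.Icc 1 k, gammaVol n * (g n) ^ (κ₀ - 6) ≤ ∑ n ∈ Finset.Icc 1 k, gammaVol n) ∧
  |Btot| ≤ 2 * B₁ * ∑ n ∈ Finset.Icc 1 k, gammaVol n

/-! **Corollary 3 (Ultraviolet Stability)** p. 264 — verbatim text and BOTH printed dependence readings are typed in
`…Balaban1983to89.B16` (`Cor3_250`, `UVBound01`, `uv01_of_cor3`).  Here only the sentence preceding it, which is the
whole printed proof of (2.50) from (2.49): *"Thus we estimate the integral ∫dV_k ρ_k by a sum of terms similar to the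
one considered in Sect. 3 [6], e.g., see (3.42). The procedure is constructed in such a way, that the combinatorics
now is the same, relative to the η-scale of the lattice T_η, as in [6], hence we have the same result for this
scale."*  ([6] = T. Bałaban, *(Higgs)₂,₃ quantum fields in a finite volume. II. An upper bound*, Commun. Math. Phys.
**86**, 555–594 (1982) — cell paper B2; its (3.42) p. 592 is the bound `… ≤ exp(O(1)|T_ε|)` proved in Sect. 3.C "The
Combinatorial Estimate" ("purely combinatoric and model-independent").  The numeric references of this paper are those
of [I] = [Balaban1987RG1]: p. 244 *"The numbers here mean the numbers in the references to [I]"*, and [I] p. 299 lists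
[6] as above, [16] = [Balaban1985UV3].  Revisions v1–v2 of this remark misread "[16]"; corrected from the render of
p. 264 — cell DIVERGENCE.md D-adv3-1, GAPS.md G-adv3-1, G-r2.5.) -/

/-! ## Surge nodes (cell LEMMAS.md §SURGE NODE CLAIM TABLE — node T11.1, unit `b2b-balaban-pv04`)

**The Theorem of p. 245** (§0 — the paper's statement of its own content) typed at the DENSITY LEVEL of the cell's
`…Balaban1983to89.Step` module (Part D1: `Step.DensityRG` = the sequence (0.2) `ρ_k = 𝐑Tρ_{k−1} = (𝐑T)^k ρ₀` with
its operations `T k : RTOp` (Setup, push-forward reading) and `R k`).  "The assumptions described in detail in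
Sect. 2" are an abstract family of predicates `S k` on densities of `T^{(k)}` (p. 262: formulated "for the effective
density obtained after the k-th operation 𝐑T"; "the space of all densities satisfying the conditions of the inductive
assumption" with index k), and "the corresponding assumptions" satisfied by the T-image are a second family
`Scorr (k+1)` on densities of `T^{(k+1)}` (p. 262: after T "the newly created expressions … are defined on slightly
larger spaces … Such improved bounds are needed for the 𝐑-operation"; p. 279: "Tρ_k represented exactly in the form
described by the inductive assumption with k+1 instead of k") — `Scorr := S` is the special case "the same
assumptions" of p. 244.  The rôle of 𝐑 is the ASSUMED property of p. 244 (`RAssumedP244`).  Bookkeeping proved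
(pure logic, the proof structure the paper states: p. 245 "This whole paper gives a proof of this, and related
theorems", Thm 1 p. 262 = the start ρ₀ + the p. 245 Theorem at each step + the assumed 𝐑, along (0.2)):
`inductiveAssumptions_of_thmP245`, `thm1Printed_of_thmP245` (⊢ `Thm1Printed`), and the second remark of p. 262
`mapsSpaces_of_thmP245Spaces` (⊢ `Step.DensityRG.MapsSpaces`, whose induction skeleton `Step.DensityRG.inSpace_all`
is NOT restated).  The base clause `S 0 ρ₀` is a HYPOTHESIS (never asserted); the clause-by-clause content of `S k`
((2.1)–(2.42)) is f2's `Step.LFHyp` / `Step.LFHypImproved` / `Step.Repr218.Holds`, bound by the paper sub-cells.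
Census: cell GAPS.md G-pv04-1 (the target space of the Theorem is specified in print only qualitatively),
DIVERGENCE.md D-pv04.1 (two-space typing; range `k < K` from (0.2)). -/

section SurgeNodes

variable {P : Params} {G : Type*} [GaugeGroup G] [MeasurableSpace G] [HaarData G] {av : ∀ j, Averaging P j G}

/-- **Theorem (p. 245 [PDF 3])**, verbatim: *"**Theorem.** If ρ_k satisfies the assumptions described in detail in
Sect. 2, then Tρ_k satisfies also the corresponding assumptions."*  Next sentence: *"This whole paper gives a proof
of this, and related theorems."*  Context, p. 244 [2]: *"Let us explain now what is the basic result of this paper.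
We give a detailed and precise description of the effective densities ρ_k in terms of convergent expansions, and we
show that Tρ_k satisfy the same assumptions. This description is quite complicated and technical, and it occupies
all of Sect. 2, so here we can formulate only a theorem, or rather an idea of a theorem, referring to the later
description. Thus we have"* [the Theorem].  Binders: `ρ k` = the k-th effective density of (0.2) p. 244 (*"ρ_k =
𝐑Tρ_{k−1} = (𝐑T)^k ρ₀, (0.2) and we finish the inductive procedure when we reach the unit lattice"* — hence
`k < K`); `T k` = the renormalization transformation of the (k+1)-st step (Setup `RTOp`); `S k` = "the assumptions
described in detail in Sect. 2" with index k (p. 262 [20]: *"All the inductive assumptions are formulated for the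
effective density obtained after the k-th operation 𝐑T."*); `Scorr (k+1)` = "the corresponding assumptions" for the
T-image — p. 262 [20]: *"It is a composition of the operations T and 𝐑, applied in this order, and after the
operation T we obtain expressions with better analyticity and decay properties. More precisely, the expressions
with indices j<k are exactly as described above, but the newly created expressions 𝐄^{(k)}, 𝐑^{(k)}, 𝐁^{(k)} are
defined on slightly larger spaces, with the coefficients in their definition bigger by β multiplied by a
corresponding number, and they have better decay properties, with the number κ replaced, for example, by (1+4β)κ.
Such improved bounds are needed for the 𝐑-operation."*; p. 279 [37]: *"After this we obtain Tρ_k represented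
exactly in the form described by the inductive assumption with k+1 instead of k. This ends the inductive proof of
this representation."*  SEQUENCE reading (ρ_k the given iterate; the reading over every density of the index-k space
is `ThmP245Spaces`).  The target space is specified in print only by the quoted sentences (cell GAPS.md G-pv04-1,
DIVERGENCE.md D-pv04.1); NOTHING is asserted — consumed only as a hypothesis. [cite: Balaban1988Convergent, Theorem p.245] -/
def ThmP245Printed (T : (k : ℕ) → RTOp P k G (av k)) (ρ : (k : ℕ) → Density P k G)
    (S Scorr : (k : ℕ) → Density P k G → Prop) (K : ℕ) : Prop :=
  ∀ k, k < K → S k (ρ k) → Scorr (k + 1) ((T k).T (ρ k))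

/-- The SPACE reading of the p. 245 Theorem, restricted to the operation T — p. 262 [20], second remark after
Theorem 1, verbatim: *"The second remark concerns a possible generalization of this theorem. For a given index k we
introduce the space of all densities satisfying the conditions of the inductive assumption. The theorem states that
the operation 𝐑T transforms the space with the index k into the space with the index k+1. This generalization does
not seem to be useful, or interesting now."*: every density of the index-k space is taken by `T k` into the
"corresponding" space.  Implies the sequence reading (`thmP245Printed_of_spaces`); together with `RAssumedP244` it
gives `Step.DensityRG.MapsSpaces` (`mapsSpaces_of_thmP245Spaces`).  Hypothesis only. [cite: Balaban1988Convergent, Theorem p.245 with remark p.262] -/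
def ThmP245Spaces (T : (k : ℕ) → RTOp P k G (av k)) (S Scorr : (k : ℕ) → Density P k G → Prop) (K : ℕ) :
    Prop :=
  ∀ k, k < K → ∀ ρ : Density P k G, S k ρ → Scorr (k + 1) ((T k).T ρ)

/-- p. 244 [PDF 2], verbatim — the 𝐑 operation is ASSUMED, not constructed, in this paper: *"The operation 𝐑 serves
this purpose. We will not describe it here, we will only assume that it has some properties incorporated in the
inductive description of the effective actions."*  Typed as the property the induction (0.2) consumes: `R k` takes
a density of `T^{(k+1)}` satisfying the "corresponding assumptions" of a T-image (`Scorr (k+1)`) to one satisfying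
the Sect. 2 assumptions with index k+1 (`S (k+1)`) — p. 279 [37]: *"Let us remark that they are not the terms in the
k+1-st effective action, because we have to perform yet the 𝐑-operation, which will change many features of the
action."*  The operation is constructed in [Balaban1989LargeFieldI]/[Balaban1989LargeFieldII] (`…B16.Thm1Printed`);
here a HYPOTHESIS only (cell DIVERGENCE.md D-pv04.1). [cite: Balaban1988Convergent, p.244] -/
def RAssumedP244 (R : (k : ℕ) → Density P (k + 1) G → Density P (k + 1) G)
    (Scorr S : (k : ℕ) → Density P k G → Prop) (K : ℕ) : Prop :=
  ∀ k, k < K → ∀ ρ' : Density P (k + 1) G, Scorr (k + 1) ρ' → S (k + 1) (R k ρ')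

/-- The space reading specialises to the sequence reading (instantiate the density at `ρ k`).  Pure logic. [folklore] -/
theorem thmP245Printed_of_spaces {T : (k : ℕ) → RTOp P k G (av k)} {S Scorr : (k : ℕ) → Density P k G → Prop}
    {K : ℕ} (h : ThmP245Spaces T S Scorr K) (ρ : (k : ℕ) → Density P k G) : ThmP245Printed T ρ S Scorr K := by
  intro k hk hS
  exact h k hk (ρ k) hS

/-- p. 262 second remark, kernel-checked from the two printed ingredients: the p. 245 Theorem (space reading, for T)
and the assumed property of 𝐑 (p. 244) compose to *"the operation 𝐑T transforms the space with the index k into the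
space with the index k+1"* = `Step.DensityRG.MapsSpaces` (f2, not restated).  Pure logic. [folklore] -/
theorem mapsSpaces_of_thmP245Spaces (D : Step.DensityRG P G av) {S Scorr : (k : ℕ) → Density P k G → Prop}
    {K : ℕ} (hT : ThmP245Spaces D.T S Scorr K) (hR : RAssumedP244 D.R Scorr S K) : D.MapsSpaces S K := by
  intro k hk ρ hS
  exact hR k hk _ (hT k hk ρ hS)

/-- THE INDUCTION ALONG (0.2) — the proof structure the paper states (p. 245 *"This whole paper gives a proof of this,
and related theorems"*; p. 279 *"This ends the inductive proof of this representation"*): a start `ρ₀` in the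
index-0 space, the p. 245 Theorem at each step `k < K` (the sequence reading suffices) and the assumed 𝐑 give `ρ_k`
in the index-k space for every `k ≤ K`, along the step law `ρ_{k+1} = 𝐑_k(T_k ρ_k)` of `Step.DensityRG`.  The start
is a HYPOTHESIS.  Pure logic (induction on k). [folklore] -/
theorem inductiveAssumptions_of_thmP245 (D : Step.DensityRG P G av) {S Scorr : (k : ℕ) → Density P k G → Prop}
    {K : ℕ} (h0 : S 0 (D.ρ 0)) (hT : ThmP245Printed D.T D.ρ S Scorr K) (hR : RAssumedP244 D.R Scorr S K) :
    ∀ k, k ≤ K → S k (D.ρ k) := by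
  intro k
  induction k with
  | zero => intro _; exact h0
  | succ k ih =>
    intro hk
    have hk' : k < K := Nat.lt_of_succ_le hk
    rw [D.step k]
    exact hR k hk' _ (hT k hk' (ih (le_of_lt hk')))

/-- **Theorem 1 (p. 262) ⇐ the Theorem of p. 245**, bookkeeping over this module's carrier `Sect2Data`: if the
abstract inductive assumption of the run is implied by membership of the run's k-th density in the index-k space
(the binding `hIA`, which the paper sub-cells supply as `Step.Repr218.Holds ∧ Step.LFHyp ∧ Step.LFHypImproved`),
then under the flow hypotheses of `Thm1Printed` ("{g_k}, determined by (0.18), (0.20) [I], satisfies (I.0.33)" —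
kept LOAD-BEARING: the start, the T-step and the 𝐑-step may each use them) the start + the p. 245 Theorem + the
assumed 𝐑 give `Thm1Printed`.  Nothing analytic is proved: `hbase` (Sect. 1, the first step), `hT` (Sect. 3 = the
printed proof of the p. 245 Theorem) and `hR` ([IV] = [Balaban1989LargeFieldI]/[Balaban1989LargeFieldII]) are the
quoted leaves.  Pure logic. [folklore] -/
theorem thm1Printed_of_thmP245 (H033 : Flow → ℕ → Prop) (Sd : Sect2Data) (D : Step.DensityRG P G av)
    (S Scorr : (k : ℕ) → Density P k G → Prop)
    (hIA : ∀ k, k ≤ Sd.K → S k (D.ρ k) → Sd.InductiveAssumption k)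
    (hbase : Sd.flow.SatisfiesRG Sd.K → H033 Sd.flow Sd.K → S 0 (D.ρ 0))
    (hT : Sd.flow.SatisfiesRG Sd.K → H033 Sd.flow Sd.K → ThmP245Printed D.T D.ρ S Scorr Sd.K)
    (hR : Sd.flow.SatisfiesRG Sd.K → H033 Sd.flow Sd.K → RAssumedP244 D.R Scorr S Sd.K) :
    Thm1Printed H033 Sd := by
  intro hrg h033 k hk
  exact hIA k hk (inductiveAssumptions_of_thmP245 D (hbase hrg h033) (hT hrg h033) (hR hrg h033) k hk)

end SurgeNodes

/-! ## Surge nodes over the inhabited carrier `RTOpI` / `Step.DensityRGI` (v4; MIGRATION TABLE row B14)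

The renormalization transformations enter the p. 245 Theorem and the induction (0.2) only through the OPERATORS
`T_k : Density_k → Density_{k+1}`; the v3 statements happen to be typed over the cell's original carrier `Setup.RTOp`
(push-forward identity `IsRT` demanded of every density — unsatisfiable as typed for a genuine averaging, cell
DIVERGENCE.md F16/F17), so that `Step.DensityRG`-valued hypotheses were vacuous.  The statements below are the same
sentences over the inhabited carrier `Setup.RTOpI` (v1.3) and the step datum `Step.DensityRGI`; along the forgetful maps
`RTOp.toRTOpI` / `DensityRG.toI` they are definitionally the v3 ones. -/

section SurgeNodesI

variable {P : Params} {G : Type*} [GaugeGroup G] [MeasurableSpace G] [HaarData G] {av : ∀ j, Averaging P j G}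

/-- The Theorem of p. 245, SEQUENCE reading (as `ThmP245Printed`, same verbatim quotations: p. 245 [PDF 3] *"Theorem.
If ρ_k satisfies the assumptions described in detail in Sect. 2, then Tρ_k satisfies also the corresponding
assumptions."*), over the inhabited carrier `RTOpI`: only the operator `(T k).T` is used.  NOTHING is asserted —
consumed only as a hypothesis. [cite: Balaban1988Convergent, Theorem p.245] -/
def ThmP245PrintedI (T : (k : ℕ) → RTOpI P k G (av k)) (ρ : (k : ℕ) → Density P k G)
    (S Scorr : (k : ℕ) → Density P k G → Prop) (K : ℕ) : Prop :=
  ∀ k, k < K → S k (ρ k) → Scorr (k + 1) ((T k).T (ρ k))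

/-- The Theorem of p. 245, SPACE reading (as `ThmP245Spaces`, same verbatim quotation of the second remark of p. 262
[PDF 20]: *"For a given index k we introduce the space of all densities satisfying the conditions of the inductive
assumption. The theorem states that the operation 𝐑T transforms the space with the index k into the space with the
index k+1."*), restricted to the operation T, over the inhabited carrier `RTOpI`.  Hypothesis only. [cite: Balaban1988Convergent, Theorem p.245 with remark p.262] -/
def ThmP245SpacesI (T : (k : ℕ) → RTOpI P k G (av k)) (S Scorr : (k : ℕ) → Density P k G → Prop) (K : ℕ) :
    Prop :=
  ∀ k, k < K → ∀ ρ : Density P k G, S k ρ → Scorr (k + 1) ((T k).T ρ)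

/-- Along `RTOp.toRTOpI` the sequence reading over `RTOpI` IS the v3 one (definitionally). [folklore] -/
theorem thmP245PrintedI_toRTOpI_iff (T : (k : ℕ) → RTOp P k G (av k)) (ρ : (k : ℕ) → Density P k G)
    (S Scorr : (k : ℕ) → Density P k G → Prop) (K : ℕ) :
    ThmP245PrintedI (fun k => (T k).toRTOpI) ρ S Scorr K ↔ ThmP245Printed T ρ S Scorr K := Iff.rfl

/-- Along `RTOp.toRTOpI` the space reading over `RTOpI` IS the v3 one (definitionally). [folklore] -/
theorem thmP245SpacesI_toRTOpI_iff (T : (k : ℕ) → RTOp P k G (av k)) (S Scorr : (k : ℕ) → Density P k G → Prop)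
    (K : ℕ) : ThmP245SpacesI (fun k => (T k).toRTOpI) S Scorr K ↔ ThmP245Spaces T S Scorr K := Iff.rfl

/-- For an old-carrier step datum `D : Step.DensityRG`, the sequence reading for `D.toI` IS the v3 one for `D`
(`Step.DensityRG.toI_T_T`, `toI_ρ`). [folklore] -/
theorem thmP245PrintedI_toI_iff (D : Step.DensityRG P G av) (S Scorr : (k : ℕ) → Density P k G → Prop) (K : ℕ) :
    ThmP245PrintedI D.toI.T D.toI.ρ S Scorr K ↔ ThmP245Printed D.T D.ρ S Scorr K := Iff.rfl

/-- For an old-carrier step datum `D : Step.DensityRG`, the space reading for `D.toI` IS the v3 one for `D`. [folklore] -/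
theorem thmP245SpacesI_toI_iff (D : Step.DensityRG P G av) (S Scorr : (k : ℕ) → Density P k G → Prop) (K : ℕ) :
    ThmP245SpacesI D.toI.T S Scorr K ↔ ThmP245Spaces D.T S Scorr K := Iff.rfl

/-- The space reading specialises to the sequence reading (inhabited carrier).  Pure logic. [folklore] -/
theorem thmP245PrintedI_of_spacesI {T : (k : ℕ) → RTOpI P k G (av k)} {S Scorr : (k : ℕ) → Density P k G → Prop}
    {K : ℕ} (h : ThmP245SpacesI T S Scorr K) (ρ : (k : ℕ) → Density P k G) : ThmP245PrintedI T ρ S Scorr K := by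
  intro k hk hS
  exact h k hk (ρ k) hS

/-- p. 262 second remark over the inhabited carrier: the p. 245 Theorem (space reading, for T) and the assumed property
of 𝐑 (p. 244, `RAssumedP244`, carrier-free) compose to *"the operation 𝐑T transforms the space with the index k into
the space with the index k+1"* = `Step.DensityRGI.MapsSpaces` (cell module `…StepInhabited`, not restated).  This is the
MIGRATION TABLE target `DensityRGI.MapsSpaces`; for `D.toI` it is `mapsSpaces_of_thmP245Spaces` by
`Step.DensityRG.toI_mapsSpaces_iff`.  Pure logic. [folklore] -/
theorem mapsSpaces_of_thmP245SpacesI (D : Step.DensityRGI P G av) {S Scorr : (k : ℕ) → Density P k G → Prop}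
    {K : ℕ} (hT : ThmP245SpacesI D.T S Scorr K) (hR : RAssumedP244 D.R Scorr S K) : D.MapsSpaces S K := by
  intro k hk ρ hS
  exact hR k hk _ (hT k hk ρ hS)

/-- THE INDUCTION ALONG (0.2) over the inhabited carrier (as `inductiveAssumptions_of_thmP245`): a start in the index-0
space, the p. 245 Theorem at each step `k < K` (sequence reading) and the assumed 𝐑 give `ρ_k` in the index-k space for
every `k ≤ K`, along the step law `ρ_{k+1} = 𝐑_k(T_k ρ_k)` of `Step.DensityRGI`.  The start is a HYPOTHESIS.  Pure logic
(induction on k). [folklore] -/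
theorem inductiveAssumptions_of_thmP245I (D : Step.DensityRGI P G av) {S Scorr : (k : ℕ) → Density P k G → Prop}
    {K : ℕ} (h0 : S 0 (D.ρ 0)) (hT : ThmP245PrintedI D.T D.ρ S Scorr K) (hR : RAssumedP244 D.R Scorr S K) :
    ∀ k, k ≤ K → S k (D.ρ k) := by
  intro k
  induction k with
  | zero => intro _; exact h0
  | succ k ih =>
    intro hk
    have hk' : k < K := Nat.lt_of_succ_le hk
    rw [D.step k]
    exact hR k hk' _ (hT k hk' (ih (le_of_lt hk')))

/-- The same conclusion through the MIGRATION TABLE's second target `Step.DensityRGI.inSpace_all` (the induction skeleton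
of `…StepInhabited`), from the SPACE reading: start + `mapsSpaces_of_thmP245SpacesI`.  Pure logic. [folklore] -/
theorem inSpace_all_of_thmP245SpacesI (D : Step.DensityRGI P G av) {S Scorr : (k : ℕ) → Density P k G → Prop}
    {K : ℕ} (h0 : S 0 (D.ρ 0)) (hT : ThmP245SpacesI D.T S Scorr K) (hR : RAssumedP244 D.R Scorr S K) :
    ∀ k, k ≤ K → S k (D.ρ k) :=
  D.inSpace_all S K h0 (mapsSpaces_of_thmP245SpacesI D hT hR)

/-- **Theorem 1 (p. 262) ⇐ the Theorem of p. 245** over the inhabited carrier (as `thm1Printed_of_thmP245`; the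
conclusion `Thm1Printed` is carrier-free and unchanged): if membership of the run's k-th density in the index-k space
implies the abstract inductive assumption (`hIA`), then under the flow hypotheses of `Thm1Printed` (kept LOAD-BEARING) the
start + the p. 245 Theorem (sequence reading over `RTOpI`) + the assumed 𝐑 give `Thm1Printed`.  Nothing analytic is
proved.  Pure logic. [folklore] -/
theorem thm1Printed_of_thmP245I (H033 : Flow → ℕ → Prop) (Sd : Sect2Data) (D : Step.DensityRGI P G av)
    (S Scorr : (k : ℕ) → Density P k G → Prop)
    (hIA : ∀ k, k ≤ Sd.K → S k (D.ρ k) → Sd.InductiveAssumption k)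
    (hbase : Sd.flow.SatisfiesRG Sd.K → H033 Sd.flow Sd.K → S 0 (D.ρ 0))
    (hT : Sd.flow.SatisfiesRG Sd.K → H033 Sd.flow Sd.K → ThmP245PrintedI D.T D.ρ S Scorr Sd.K)
    (hR : Sd.flow.SatisfiesRG Sd.K → H033 Sd.flow Sd.K → RAssumedP244 D.R Scorr S Sd.K) :
    Thm1Printed H033 Sd := by
  intro hrg h033 k hk
  exact hIA k hk (inductiveAssumptions_of_thmP245I D (hbase hrg h033) (hT hrg h033) (hR hrg h033) k hk)

end SurgeNodesI

end Literature.MathematicalPhysics.QuantumFieldTheory.Balaban1983to89.B14
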